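import Mathlib
import Literature.Computability.AlgebraicComplexity.OdlyzkoHypercubeSubspace

/-!
# Odlyzko's lemma (hypercube form) — proof of the named fact `odlyzko_ncard_hypercube_inter_translate_le`

Discharges the named fact of `OdlyzkoHypercubeSubspace.lean` [Odlyzko1988, proof of Prop. 2.2, p. 127]: for a field
`K`, a subspace `V ≤ Kᴺ` and a base point `x₀`, the translate `x₀ + V` contains at most `2 ^ finrank V` points of the
hypercube `{0,1}ᴺ`.  Proof (the printed pivot-coordinate argument, any field): the coordinate functionals restricted
to `V` contain a maximal linearly independent subfamily indexed by a set `T` of coordinates (`exists_maximal_linearIndepOn`);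
`|T| ≤ finrank V` and every other coordinate functional is, on `V`, a combination of those in `T`, so a vector of `V`
vanishing on `T` vanishes (`exists_pivotCoordinates`).  Two hypercube points of the translate with the same pattern of
`1`s on `T` then differ by a vector of `V` vanishing on `T`, i.e. coincide; hence the points inject into the power set
of `T`. [cite: Odlyzko1988, proof of Prop. 2.2, p. 127]
-/

namespace Literature.Computability.AlgebraicComplexity

universe u

open Module

/-- **Pivot coordinates.** A subspace `V ≤ Kᴺ` admits a set `T` of at most `finrank V` coordinates on which no
non-zero vector of `V` vanishes identically (the restrictions to `V` of the coordinate functionals indexed by `T` form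
a maximal linearly independent subfamily, hence span all restricted coordinate functionals up to non-zero scalars).
[cite: Odlyzko1988, proof of Prop. 2.2, p. 127] -/
theorem exists_pivotCoordinates (K : Type u) [Field K] (N : ℕ) (V : Submodule K (Fin N → K)) :
    ∃ T : Finset (Fin N), T.card ≤ finrank K V ∧ ∀ v ∈ V, (∀ i ∈ T, v i = 0) → v = 0 := by
  classical
  let φ : Fin N → Module.Dual K V := fun i => (LinearMap.proj i).comp V.subtype
  have hφ : ∀ i (v : V), φ i v = (v : Fin N → K) i := fun i v => rfl
  obtain ⟨s, hli, hmax⟩ := exists_maximal_linearIndepOn K φ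
  refine ⟨s.toFinset, ?_, ?_⟩
  · have h1 : Fintype.card s ≤ finrank K (Module.Dual K V) :=
      LinearIndependent.fintype_card_le_finrank hli
    rw [Set.toFinset_card]
    rwa [Subspace.dual_finrank_eq] at h1
  · intro v hv hzero
    have hkill : ∀ f ∈ Submodule.span K (φ '' s), f ⟨v, hv⟩ = 0 := by
      intro f hf
      induction hf using Submodule.span_induction with
      | mem f hf =>
        obtain ⟨i, hi, rfl⟩ := hf
        rw [hφ]
        exact hzero i (Set.mem_toFinset.2 hi)
      | zero => simp
      | add f g _ _ hf hg => simp [hf, hg]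
      | smul a f _ hf => simp [hf]
    funext i
    by_cases hi : i ∈ s
    · exact hzero i (Set.mem_toFinset.2 hi)
    · obtain ⟨a, ha, hmem⟩ := hmax i hi
      have h0 := hkill _ hmem
      rw [LinearMap.smul_apply, hφ, smul_eq_mul] at h0
      simpa using (mul_eq_zero.1 h0).resolve_left ha

/-- **Odlyzko's lemma (hypercube form), proved**: `#{x ∈ {0,1}ᴺ : x - x₀ ∈ V} ≤ 2 ^ finrank V`.
[cite: Odlyzko1988, proof of Prop. 2.2, p. 127] -/
theorem odlyzko_ncard_hypercube_inter_translate_le_holds : odlyzko_ncard_hypercube_inter_translate_le.{u} := by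
  intro K _ N V x₀
  classical
  obtain ⟨T, hT, hsep⟩ := exists_pivotCoordinates K N V
  let h : (Fin N → K) → Finset (Fin N) := fun x => T.filter (fun i => x i = 1)
  have hmaps : ∀ x ∈ {x : Fin N → K | (∀ i, x i = 0 ∨ x i = 1) ∧ x - x₀ ∈ V},
      h x ∈ ((T.powerset : Finset (Finset (Fin N))) : Set (Finset (Fin N))) := by
    intro x _
    simp only [Finset.coe_powerset, Set.mem_preimage, Set.mem_powerset_iff, Finset.coe_subset]
    exact Finset.filter_subset _ T
  have hinj : Set.InjOn h {x : Fin N → K | (∀ i, x i = 0 ∨ x i = 1) ∧ x - x₀ ∈ V} := by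
    rintro x ⟨hx01, hxV⟩ y ⟨hy01, hyV⟩ hxy
    have hdiff : x - y ∈ V := by
      have hsub := V.sub_mem hxV hyV
      rwa [sub_sub_sub_cancel_right] at hsub
    have hzero : ∀ i ∈ T, (x - y) i = 0 := by
      intro i hi
      have key : x i = 1 ↔ y i = 1 := by
        have hx : i ∈ h x ↔ x i = 1 := by simp [h, hi]
        have hy : i ∈ h y ↔ y i = 1 := by simp [h, hi]
        rw [← hx, ← hy, hxy]
      rw [Pi.sub_apply, sub_eq_zero]
      rcases hx01 i with hx | hx
      · rcases hy01 i with hy | hy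
        · rw [hx, hy]
        · exact absurd (key.2 hy) (by rw [hx]; exact zero_ne_one)
      · rw [hx, key.1 hx]
    exact sub_eq_zero.1 (hsep _ hdiff hzero)
  calc {x : Fin N → K | (∀ i, x i = 0 ∨ x i = 1) ∧ x - x₀ ∈ V}.ncard
      ≤ ((T.powerset : Finset (Finset (Fin N))) : Set (Finset (Fin N))).ncard :=
        Set.ncard_le_ncard_of_injOn h hmaps hinj
    _ = 2 ^ T.card := by rw [Set.ncard_coe_finset, Finset.card_powerset]
    _ ≤ 2 ^ finrank K V := Nat.pow_le_pow_right (by norm_num) hT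

/-! ### The same over an arbitrary finite coordinate type

The pivot argument does not use the linear order of `Fin N`; for index types such as `Fin n ⊕ Fin n` (row and
column characters of a torus) the following forms avoid a transport along `finSumFinEquiv`. -/

/-- Pivot coordinates for a subspace of `K^ι`, `ι` any finite type: at most `finrank V` coordinates on which no
non-zero vector of `V` vanishes identically. [cite: Odlyzko1988, proof of Prop. 2.2, p. 127] -/
theorem exists_pivotCoordinates_fintype (K : Type u) [Field K] {ι : Type*} [Fintype ι]
    (V : Submodule K (ι → K)) :
    ∃ T : Finset ι, T.card ≤ finrank K V ∧ ∀ v ∈ V, (∀ i ∈ T, v i = 0) → v = 0 := by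
  classical
  let φ : ι → Module.Dual K V := fun i => (LinearMap.proj i).comp V.subtype
  have hφ : ∀ i (v : V), φ i v = (v : ι → K) i := fun i v => rfl
  obtain ⟨s, hli, hmax⟩ := exists_maximal_linearIndepOn K φ
  refine ⟨s.toFinset, ?_, ?_⟩
  · have h1 : Fintype.card s ≤ finrank K (Module.Dual K V) :=
      LinearIndependent.fintype_card_le_finrank hli
    rw [Set.toFinset_card]
    rwa [Subspace.dual_finrank_eq] at h1
  · intro v hv hzero
    have hkill : ∀ f ∈ Submodule.span K (φ '' s), f ⟨v, hv⟩ = 0 := by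
      intro f hf
      induction hf using Submodule.span_induction with
      | mem f hf =>
        obtain ⟨i, hi, rfl⟩ := hf
        rw [hφ]
        exact hzero i (Set.mem_toFinset.2 hi)
      | zero => simp
      | add f g _ _ hf hg => simp [hf, hg]
      | smul a f _ hf => simp [hf]
    funext i
    by_cases hi : i ∈ s
    · exact hzero i (Set.mem_toFinset.2 hi)
    · obtain ⟨a, ha, hmem⟩ := hmax i hi
      have h0 := hkill _ hmem
      rw [LinearMap.smul_apply, hφ, smul_eq_mul] at h0
      simpa using (mul_eq_zero.1 h0).resolve_left ha

/-- **Odlyzko's lemma over any finite coordinate type**: for a field `K`, a finite type `ι`, a subspace `V ≤ K^ι`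
and a base point `x₀`, `#{x ∈ {0,1}^ι : x - x₀ ∈ V} ≤ 2 ^ finrank V`.
[cite: Odlyzko1988, proof of Prop. 2.2, p. 127] -/
theorem ncard_hypercube_inter_translate_le (K : Type u) [Field K] {ι : Type*} [Fintype ι]
    (V : Submodule K (ι → K)) (x₀ : ι → K) :
    {x : ι → K | (∀ i, x i = 0 ∨ x i = 1) ∧ x - x₀ ∈ V}.ncard ≤ 2 ^ finrank K V := by
  classical
  obtain ⟨T, hT, hsep⟩ := exists_pivotCoordinates_fintype K V
  let h : (ι → K) → Finset ι := fun x => T.filter (fun i => x i = 1)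
  have hmaps : ∀ x ∈ {x : ι → K | (∀ i, x i = 0 ∨ x i = 1) ∧ x - x₀ ∈ V},
      h x ∈ ((T.powerset : Finset (Finset ι)) : Set (Finset ι)) := by
    intro x _
    simp only [Finset.coe_powerset, Set.mem_preimage, Set.mem_powerset_iff, Finset.coe_subset]
    exact Finset.filter_subset _ T
  have hinj : Set.InjOn h {x : ι → K | (∀ i, x i = 0 ∨ x i = 1) ∧ x - x₀ ∈ V} := by
    rintro x ⟨hx01, hxV⟩ y ⟨hy01, hyV⟩ hxy
    have hdiff : x - y ∈ V := by
      have hsub := V.sub_mem hxV hyV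
      rwa [sub_sub_sub_cancel_right] at hsub
    have hzero : ∀ i ∈ T, (x - y) i = 0 := by
      intro i hi
      have key : x i = 1 ↔ y i = 1 := by
        have hx : i ∈ h x ↔ x i = 1 := by simp [h, hi]
        have hy : i ∈ h y ↔ y i = 1 := by simp [h, hi]
        rw [← hx, ← hy, hxy]
      rw [Pi.sub_apply, sub_eq_zero]
      rcases hx01 i with hx | hx
      · rcases hy01 i with hy | hy
        · rw [hx, hy]
        · exact absurd (key.2 hy) (by rw [hx]; exact zero_ne_one)
      · rw [hx, key.1 hx]
    exact sub_eq_zero.1 (hsep _ hdiff hzero)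
  calc {x : ι → K | (∀ i, x i = 0 ∨ x i = 1) ∧ x - x₀ ∈ V}.ncard
      ≤ ((T.powerset : Finset (Finset ι)) : Set (Finset ι)).ncard :=
        Set.ncard_le_ncard_of_injOn h hmaps hinj
    _ = 2 ^ T.card := by rw [Set.ncard_coe_finset, Finset.card_powerset]
    _ ≤ 2 ^ finrank K V := Nat.pow_le_pow_right (by norm_num) hT

/-- The linear (`x₀ = 0`) case over any finite coordinate type: a subspace of dimension `d` of `K^ι` contains at
most `2^d` hypercube vertices. [cite: Odlyzko1988, proof of Prop. 2.2, p. 127] -/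
theorem ncard_hypercube_inter_le (K : Type u) [Field K] {ι : Type*} [Fintype ι] (V : Submodule K (ι → K)) :
    {x : ι → K | (∀ i, x i = 0 ∨ x i = 1) ∧ x ∈ V}.ncard ≤ 2 ^ finrank K V := by
  simpa using ncard_hypercube_inter_translate_le K V 0

end Literature.Computability.AlgebraicComplexity
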